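import Summits.BirchSwinnertonDyer.BirchSwinnertonDyer.Theses.ByReductionTypeAtTwo
import Summits.BirchSwinnertonDyer.BirchSwinnertonDyer.Theorems.ByReductionTypeAtTwoGoodOrdinaryPub
import HarnessLib

/-!
# Route `ByReductionTypeAtTwo` (rung K4, row B1·O1): the GLUE item `GoodOrdinaryRankZeroAtTwoOfChildren`
# — the good-ordinary formula crux from its three children

Cell `bsd-2adic` (run/shared/lean/pub/bsd-2adic/), seat `bsd-2adic-conv-1` (the K4 glue twin of the
S3 glue `goodOrdinaryRankZeroTwoConverseOfChildren_proof`, p416617). THEOREMS ONLY; nothing asserted,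
no definition, no named fact introduced.

The crux `GoodOrdinaryRankZeroAtTwo` (item stmt-BirchSwinnertonDyer-19095: BSD₂ for every non-CM
`E/ℚ` of analytic rank `0` good ORDINARY at `2`) was split (gen 1) into the SUPPORT child
`OrdPublishedInputsAtTwo` (item 19149: modularity ∧ Gross–Zagier–Kolyvagin ∧ Kato 17.4 (1)(2) at `2`
∧ Greenberg Thm. 4.1 parity-free, = `Literature.Uncategorized.OrdPublishedInputsAtTwo`), the CRUX
children `OrdKatoHalfAtTwo` (item 19150, the Kato–Néron half) and `OrdEisensteinHalfAtTwo` (item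
19151, the Eisenstein half; both = the `Theorems.OrdHalvesAtTwo` constants), and the glue item
`GoodOrdinaryRankZeroAtTwoOfChildren` (item 19152):
`OrdPublishedInputsAtTwo → OrdKatoHalfAtTwo → OrdEisensteinHalfAtTwo → GoodOrdinaryRankZeroAtTwo`.
This file proves the glue item with its FULLY-QUALIFIED route type in one line from the landed PUB
bridge `goodOrdinaryRankZeroAtTwo_of_facts_of_halves` (Theorems/ByReductionTypeAtTwoGoodOrdinaryPub.lean,
p409439; the planner's kernel certificate plan/routes/split-g10/Sketch-S1.lean): the two halves give
the `2`-adic main conjecture at a datum, Greenberg 4.1@2 + interpolation give `BSD(E,2)`.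

HONEST FRAMING: closing the glue item moves NO mathematics — the crux is exactly as open as its two
halves 19150/19151; BSD is not proved by any of this; a closed item closes a leaf of rung K4 of
BirchSwinnertonDyer, never summit credit. PARTITION (D-0054): X5@2 good-ord (B1·O1; 611 book230
classes) × p = 2 — types-the-object-of (bookkeeping glue); closes none.

References: [GreenbergLNM1716] Thm. 4.1 (p. 102); [Kato2004Asterisque] Thm. 17.4 (1)(2) (p. 273);
[SkinnerUrban2014] §3.6 (shape; p odd); [MazurTateTeitelbaum1986Invent] §I.14.
-/

set_option linter.dupNamespace false
set_option autoImplicit false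

namespace Summit.BirchSwinnertonDyer.BirchSwinnertonDyer.Theorems

open Summit.BirchSwinnertonDyer.BirchSwinnertonDyer.Theses.ByReductionTypeAtTwo

/-- **GLUE item `GoodOrdinaryRankZeroAtTwoOfChildren` (stmt-BirchSwinnertonDyer-19152), proved.**
The four PUBLISHED inputs (modularity, Gross–Zagier–Kolyvagin, Kato 17.4 (1)(2) at `2`, Greenberg
Thm. 4.1 parity-free), the Kato–Néron half and the Eisenstein half of the `2`-adic main conjecture on
the class imply `GoodOrdinaryRankZeroAtTwo` (BSD₂ for every non-CM `E/ℚ` of analytic rank `0` good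
ordinary at `2`) — one application of the landed bridge `goodOrdinaryRankZeroAtTwo_of_facts_of_halves`
(p409439); the Eisenstein child is rank-free, so its rank hypothesis is dropped.
[cite: GreenbergLNM1716, Thm. 4.1 (p. 102)] [cite: Kato2004Asterisque, Thm. 17.4 (1)(2) (p. 273)] -/
theorem goodOrdinaryRankZeroAtTwoOfChildren_proof :
    Summit.BirchSwinnertonDyer.BirchSwinnertonDyer.Theses.ByReductionTypeAtTwo.GoodOrdinaryRankZeroAtTwoOfChildren := by
  unfold GoodOrdinaryRankZeroAtTwoOfChildren OrdPublishedInputsAtTwo OrdKatoHalfAtTwo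
    OrdEisensteinHalfAtTwo
  rintro ⟨hmod, hGZK, h17, hGr⟩ hK hE
  exact goodOrdinaryRankZeroAtTwo_of_facts_of_halves hmod hGZK h17 hGr
    (fun W _ _ hcm hr hgo => hK W hcm hr hgo) (fun W _ _ hcm _ hgo => hE W hcm hgo)

end Summit.BirchSwinnertonDyer.BirchSwinnertonDyer.Theorems
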